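import Summits.ABC.ABC.Theorems.SoloBlindFormsBezout
import Summits.ABC.ABC.Theorems.SoloBlindCoveringNoGain
import HarnessLib

/-!
# The forms–evaluation bridge: a polynomial identity yields covering data (C4″, part 3)

Solo seat `solo-ABC-blind` (ideation tier, summit-directed), session 6.

Let `a + b = c` in `ℤ[X]` with `deg c = n ≥ 1`, `deg a ≤ n`, `a, b ≠ 0`, `a, c` coprime over `ℚ`,
and let a factorisation `a b c = d · X^α (X − 1)^γ · ∏ᵢ Pᵢ^{eᵢ}` (`eᵢ ≥ 1`) be given.  Evaluating
the degree-`n` forms at coprime `0 < u < v` and normalising signs and the bounded gcd gives, for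
every such `(u, v)`, an abc triple `(a', b', c')` with

  `c' ≥ κ vⁿ`  and  `rad(a' b' c') ≤ M · rad(u v (v − u)) · v^s`,  `s = Σᵢ deg Pᵢ`

(`coveringData_of_forms`): this is exactly the hypothesis of `no_covering_gain` /
`radFloor_of_coveringData` (file `SoloBlindCoveringNoGain`), so every identity transfers
`PolyABC K` into the floor exponent `(n − K s)/K ≤ 1/K` on `rad(u v (v − u))`
(`forms_no_gain`), with equality iff `K = 1 ∧ s = n − 1` (Belyi‑extremal, cf. Mason 1984
[Mason1984]: `s ≥ n − 1` is the projective Mason–Stothers count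
`Literature.NumberTheory.DiophantineGeometry.Mason1984.mason_projective`).

References: folklore (functoriality of heights and of the radical under rational maps
`ℙ¹ → ℙ¹`); the seat's WALL.md §2 (C4″).
-/

noncomputable section

open Polynomial Finset UniqueFactorizationMonoid
open Literature.NumberTheory.DiophantineGeometry

namespace Summit.ABC.ABC.Theorems

/-! ### Small helpers on radicals in `ℕ` -/

/-- `rad(y^k) ∣ rad(y)`. [folklore] -/
theorem radical_pow_dvd_radical (y k : ℕ) : radical (y ^ k) ∣ radical y := by
  rcases Nat.eq_zero_or_pos k with rfl | hk
  · simp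
  · rw [radical_pow y hk.ne']

/-- `rad(∏ fᵢ) ∣ ∏ rad(fᵢ)`. [folklore] -/
theorem radical_prod_dvd {ι : Type*} (s : Finset ι) (f : ι → ℕ) :
    radical (∏ i ∈ s, f i) ∣ ∏ i ∈ s, radical (f i) := by
  classical
  induction s using Finset.induction_on with
  | empty => simp
  | insert i s hi ih =>
    rw [Finset.prod_insert hi, Finset.prod_insert hi]
    exact radical_mul_dvd.trans (mul_dvd_mul_left _ ih)

/-- `rad(v^β u^α w^γ) ∣ rad(u v w)` for positive `u v w`. [folklore] -/
theorem radical_special_dvd (u v w α β γ : ℕ) (hu : 0 < u) (hv : 0 < v) (hw : 0 < w) :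
    radical (v ^ β * u ^ α * w ^ γ) ∣ radical (u * v * w) := by
  have h1 : v ^ β * u ^ α * w ^ γ ∣ (u * v * w) ^ (α + β + γ) := by
    have : (u * v * w) ^ (α + β + γ) =
        (u ^ β * w ^ β) * v ^ β * ((v ^ α * w ^ α) * u ^ α) * ((u ^ γ * v ^ γ) * w ^ γ) := by
      rw [pow_add, pow_add, mul_pow, mul_pow, mul_pow, mul_pow, mul_pow, mul_pow]; ring
    rw [this]
    exact mul_dvd_mul (mul_dvd_mul (dvd_mul_left _ _) (dvd_mul_left _ _)) (dvd_mul_left _ _)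
  exact (radical_dvd_radical h1 (by positivity)).trans (radical_pow_dvd_radical _ _)

/-! ### Sign and gcd normalisation of an integer solution of `x + y = z` -/

/-- An integer solution of `x + y = z` in nonzero coprime integers rearranges into an abc triple
with the same product of absolute values and `c ≥ |x|, |z|`. [folklore] -/
theorem exists_isABCTriple_of_int_sum {x y z : ℤ} (hsum : x + y = z) (hx : x ≠ 0) (hy : y ≠ 0)
    (hz : z ≠ 0) (hcop : IsCoprime x y) :
    ∃ a b c : ℕ, IsABCTriple a b c ∧ a * b * c = (x * y * z).natAbs ∧
      x.natAbs ≤ c ∧ z.natAbs ≤ c := by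
  have hyz : IsCoprime y z := by
    have := hcop.symm.add_mul_left_right 1; rwa [mul_one, hsum] at this
  have hxz : IsCoprime x z := by
    have := hcop.add_mul_left_right 1; rwa [mul_one, add_comm, hsum] at this
  have cxy : Nat.Coprime x.natAbs y.natAbs := by
    rw [Nat.Coprime, ← Int.gcd_eq_natAbs]; exact Int.isCoprime_iff_gcd_eq_one.mp hcop
  have cyz : Nat.Coprime y.natAbs z.natAbs := by
    rw [Nat.Coprime, ← Int.gcd_eq_natAbs]; exact Int.isCoprime_iff_gcd_eq_one.mp hyz
  have cxz : Nat.Coprime x.natAbs z.natAbs := by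
    rw [Nat.Coprime, ← Int.gcd_eq_natAbs]; exact Int.isCoprime_iff_gcd_eq_one.mp hxz
  have hprod1 : x.natAbs * y.natAbs * z.natAbs = (x * y * z).natAbs := by
    rw [Int.natAbs_mul, Int.natAbs_mul]
  -- three shapes
  by_cases h1 : x.natAbs + y.natAbs = z.natAbs
  · exact ⟨x.natAbs, y.natAbs, z.natAbs, ⟨by omega, by omega, h1, cxy⟩, hprod1, by omega, le_rfl⟩
  by_cases h2 : y.natAbs + z.natAbs = x.natAbs
  · refine ⟨y.natAbs, z.natAbs, x.natAbs, ⟨by omega, by omega, h2, cyz⟩, ?_, le_rfl, by omega⟩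
    rw [← hprod1]; ring
  have h3 : x.natAbs + z.natAbs = y.natAbs := by omega
  refine ⟨x.natAbs, z.natAbs, y.natAbs, ⟨by omega, by omega, h3, cxz⟩, ?_, by omega, by omega⟩
  rw [← hprod1]; ring

/-! ### The bridge -/

/-- **Forms–evaluation bridge.**  A polynomial identity `a + b = c` over `ℤ` of degree `n` with a
given factorisation of `a b c` yields covering data with exponent `s = Σᵢ deg Pᵢ` (the number of
zeros of `a b c` on `ℙ¹` outside `{0, 1, ∞}`, counted over `ℚ̄` when the `Pᵢ` are the distinct
irreducible factors). [folklore] -/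
theorem coveringData_of_forms {a b c : ℤ[X]} {n : ℕ} (hn : 1 ≤ n) (hsum : a + b = c)
    (hc : c.natDegree = n) (ha : a.natDegree ≤ n) (ha0 : a ≠ 0) (hb0 : b ≠ 0)
    (hcop : IsCoprime (a.map (Int.castRingHom ℚ)) (c.map (Int.castRingHom ℚ)))
    {m : ℕ} {d : ℤ} {α γ : ℕ} {P : Fin m → ℤ[X]} {e : Fin m → ℕ} (he : ∀ i, 0 < e i)
    (hfac : a * b * c = C d * X ^ α * (X - 1) ^ γ * ∏ i, P i ^ e i) :
    ∃ κ M : ℝ, 0 < κ ∧ 0 < M ∧ ∀ u v : ℕ, 0 < u → u < v → Nat.Coprime u v →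
      ∃ a' b' c' : ℕ, IsABCTriple a' b' c' ∧ κ * (v : ℝ) ^ n ≤ (c' : ℝ) ∧
        ((rad a' b' c' : ℕ) : ℝ) ≤
          M * ((radical (u * v * (v - u)) : ℕ) : ℝ) * (v : ℝ) ^ (∑ i, (P i).natDegree) := by
  classical
  obtain ⟨L, G, hL, hG, hLG⟩ := forms_height_gcd_bound a c hn ha hc hcop
  have hc0 : c ≠ 0 := by rintro rfl; simp at hc; omega
  have habc0 : a * b * c ≠ 0 := mul_ne_zero (mul_ne_zero ha0 hb0) hc0
  have hb : b.natDegree ≤ n := by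
    have : b = c - a := by rw [← hsum]; ring
    rw [this]; exact (natDegree_sub_le _ _).trans (max_le hc.le ha)
  have hd0 : d ≠ 0 := by
    rintro rfl; rw [C_0, zero_mul, zero_mul, zero_mul] at hfac; exact habc0 hfac
  have hP0 : ∀ i, P i ≠ 0 := by
    intro i hi; apply habc0; rw [hfac]
    rw [Finset.prod_eq_zero (Finset.mem_univ i) (by rw [hi, zero_pow (he i).ne'])]; simp
  -- the 1-norms of the `Pᵢ`
  let NP : Fin m → ℕ := fun i => ∑ k ∈ range ((P i).natDegree + 1), ((P i).coeff k).natAbs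
  have hNPcast : ∀ i, ((NP i : ℕ) : ℤ) = ∑ k ∈ range ((P i).natDegree + 1), |(P i).coeff k| := by
    intro i; simp [NP]
  have hNP1 : ∀ i, 1 ≤ NP i := by
    intro i
    have hmem : (P i).natDegree ∈ range ((P i).natDegree + 1) := by simp
    have : ((P i).coeff (P i).natDegree).natAbs ≤ NP i :=
      Finset.single_le_sum (f := fun k => ((P i).coeff k).natAbs) (fun _ _ => Nat.zero_le _) hmem
    have h1 : 1 ≤ ((P i).coeff (P i).natDegree).natAbs :=
      Int.natAbs_pos.mpr (by rw [Polynomial.coeff_natDegree]; exact leadingCoeff_ne_zero.mpr (hP0 i))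
    omega
  -- threshold and constants
  let v₀ : ℕ := max (max a.leadingCoeff.natAbs b.leadingCoeff.natAbs) c.leadingCoeff.natAbs
  let M : ℝ := (d.natAbs : ℝ) * ∏ i, (NP i : ℝ)
  have hM1 : 1 ≤ M := by
    have h1 : (1 : ℝ) ≤ (d.natAbs : ℝ) := by exact_mod_cast Int.natAbs_pos.mpr hd0
    have h2 : (1 : ℝ) ≤ ∏ i, (NP i : ℝ) := by
      rw [← Finset.prod_const_one (s := (univ : Finset (Fin m)))]
      exact Finset.prod_le_prod (fun _ _ => zero_le_one) fun i _ => by exact_mod_cast hNP1 i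
    nlinarith
  let κ : ℝ := 1 / (((L : ℝ) * G) * ((v₀ : ℝ) + 1) ^ n)
  have hLGpos : (0 : ℝ) < (L : ℝ) * G := by positivity
  have hκ : 0 < κ := by positivity
  refine ⟨κ, M, hκ, by linarith, fun u v hu huv hcuv => ?_⟩
  have hvpos : 0 < v := by omega
  have hspec_pos : 0 < radical (u * v * (v - u)) := Nat.pos_of_ne_zero radical_ne_zero
  by_cases hv : v₀ < v
  · /- main case: the three values are nonzero -/
    set U : ℤ := (u : ℤ) with hU
    set V : ℤ := (v : ℤ) with hV
    have hcUV : IsCoprime U V := Nat.isCoprime_iff_coprime.mpr hcuv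
    have hUV : |U| ≤ V := by rw [abs_of_nonneg (by omega)]; omega
    have hV0 : 0 < V := by omega
    have hlt : ∀ p : ℤ[X], p.leadingCoeff.natAbs < v → |p.leadingCoeff| < V := by
      intro p hp; rw [Int.abs_eq_natAbs, hV]; exact_mod_cast hp
    have hva : |a.leadingCoeff| < V := hlt a (by omega)
    have hvb : |b.leadingCoeff| < V := hlt b (by omega)
    have hvc : |c.leadingCoeff| < V := hlt c (by omega)
    set A := MvPolynomial.eval ![U, V] (a.homogenize n) with hA
    set B := MvPolynomial.eval ![U, V] (b.homogenize n) with hB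
    set Cv := MvPolynomial.eval ![U, V] (c.homogenize n) with hCv
    have hA0 : A ≠ 0 := eval_homogenize_ne_zero' ha0 ha hcUV hva
    have hB0 : B ≠ 0 := eval_homogenize_ne_zero' hb0 hb hcUV hvb
    have hC0 : Cv ≠ 0 := eval_homogenize_ne_zero' hc0 hc.le hcUV hvc
    have hABC : A + B = Cv := by
      rw [hA, hB, hCv, ← map_add, ← Polynomial.homogenize_add, hsum]
    obtain ⟨hheight, hgcd⟩ := hLG U V hcUV hUV hV0
    -- remove the gcd
    set g : ℕ := Int.gcd A Cv with hg
    have hg0 : 0 < g := Int.gcd_pos_of_ne_zero_left Cv hA0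
    have hg0' : (g : ℤ) ≠ 0 := by exact_mod_cast hg0.ne'
    obtain ⟨x, hx⟩ : (g : ℤ) ∣ A := Int.gcd_dvd_left A Cv
    obtain ⟨z, hz⟩ : (g : ℤ) ∣ Cv := Int.gcd_dvd_right A Cv
    obtain ⟨y, hy⟩ : (g : ℤ) ∣ B := by
      have : B = Cv - A := by rw [← hABC]; ring
      rw [this]; exact dvd_sub ⟨z, hz⟩ ⟨x, hx⟩
    have hxyz : x + y = z := by
      apply mul_left_cancel₀ hg0'
      rw [mul_add, ← hx, ← hy, ← hz, hABC]
    have hx0 : x ≠ 0 := by rintro rfl; simp at hx; exact hA0 hx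
    have hy0 : y ≠ 0 := by rintro rfl; simp at hy; exact hB0 hy
    have hz0 : z ≠ 0 := by rintro rfl; simp at hz; exact hC0 hz
    have hgxz : Int.gcd x z = 1 := by
      have h1 : Int.gcd A Cv = g := rfl
      rw [hx, hz, Int.gcd_mul_left, Int.natAbs_natCast] at h1
      exact Nat.eq_of_mul_eq_mul_left hg0 (h1.trans (mul_one g).symm)
    have hcxz : IsCoprime x z := Int.isCoprime_iff_gcd_eq_one.mpr hgxz
    have hcxy : IsCoprime x y := by
      have := hcxz.add_mul_left_right (-1)
      rwa [show z + x * (-1) = y by linarith] at this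
    obtain ⟨a', b', c', hT, hprod, hxa, hzc⟩ := exists_isABCTriple_of_int_sum hxyz hx0 hy0 hz0 hcxy
    refine ⟨a', b', c', hT, ?_, ?_⟩
    · /- height -/
      have hgG : g ≤ G := Nat.le_of_dvd hG hgcd
      have hmax : max |A| |Cv| ≤ (g : ℤ) * c' := by
        rw [hx, hz, abs_mul, abs_mul, Int.abs_eq_natAbs x, Int.abs_eq_natAbs z,
          abs_of_nonneg (by positivity : (0 : ℤ) ≤ g)]
        refine max_le ?_ ?_
        · exact mul_le_mul_of_nonneg_left (by exact_mod_cast hxa) (by positivity)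
        · exact mul_le_mul_of_nonneg_left (by exact_mod_cast hzc) (by positivity)
      have h1 : (v : ℤ) ^ n ≤ (L : ℤ) * G * c' := by
        calc (v : ℤ) ^ n ≤ L * max |A| |Cv| := hheight
          _ ≤ L * ((g : ℤ) * c') := by gcongr
          _ ≤ L * ((G : ℤ) * c') := by gcongr
          _ = L * G * c' := by ring
      have h1R : (v : ℝ) ^ n ≤ (L : ℝ) * G * c' := by exact_mod_cast h1
      have hp : (1 : ℝ) ≤ ((v₀ : ℝ) + 1) ^ n := one_le_pow₀ (by linarith [(Nat.cast_nonneg v₀ : (0:ℝ) ≤ v₀)])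
      have hc'0 : (0 : ℝ) ≤ c' := Nat.cast_nonneg _
      show 1 / (((L : ℝ) * G) * ((v₀ : ℝ) + 1) ^ n) * (v : ℝ) ^ n ≤ c'
      rw [div_mul_eq_mul_div, one_mul, div_le_iff₀ (by positivity)]
      nlinarith [mul_nonneg (mul_nonneg hLGpos.le hc'0) (sub_nonneg.mpr hp)]
    · /- radical -/
      -- the product of the three values, from the factorisation
      set S : ℕ := ∑ i, e i * (P i).natDegree with hS
      have hX1deg : (X - 1 : ℤ[X]).natDegree = 1 := by
        rw [show (X - 1 : ℤ[X]) = X - C 1 by rw [C_1]]; exact natDegree_X_sub_C 1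
      have hX1 : (X - 1 : ℤ[X]) ≠ 0 := by
        intro h; rw [h] at hX1deg; simp at hX1deg
      have hdegabc : (a * b * c).natDegree = α + γ + S := by
        have h1 : (C d * X ^ α : ℤ[X]) ≠ 0 :=
          mul_ne_zero (C_ne_zero.mpr hd0) (pow_ne_zero _ X_ne_zero)
        have h2 : ((X - 1 : ℤ[X]) ^ γ) ≠ 0 := pow_ne_zero _ hX1
        have h3 : (∏ i, P i ^ e i) ≠ 0 :=
          Finset.prod_ne_zero_iff.mpr fun i _ => pow_ne_zero _ (hP0 i)
        rw [hfac, natDegree_mul (mul_ne_zero h1 h2) h3, natDegree_mul h1 h2,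
          natDegree_mul (C_ne_zero.mpr hd0) (pow_ne_zero _ X_ne_zero), natDegree_C, natDegree_pow,
          natDegree_X, natDegree_pow, hX1deg, natDegree_prod _ _ (fun i _ => pow_ne_zero _ (hP0 i))]
        simp [natDegree_pow, hS]
      have hdeg3 : α + γ + S ≤ n + n + n := by
        rw [← hdegabc]
        exact natDegree_mul_le.trans (add_le_add (natDegree_mul_le.trans (add_le_add ha hb)) hc.le)
      set β : ℕ := n + n + n - (α + γ + S) with hβ
      -- values of the `Pᵢ`-forms
      set q : Fin m → ℤ := fun i => MvPolynomial.eval ![U, V] ((P i).homogenize (P i).natDegree)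
        with hq
      have HABC : A * B * Cv = d * V ^ β * U ^ α * (U - V) ^ γ * ∏ i, q i ^ e i := by
        have e1 : A * B * Cv = MvPolynomial.eval ![U, V] ((a * b * c).homogenize (n + n + n)) := by
          rw [Polynomial.homogenize_mul _ _ (natDegree_mul_le.trans (add_le_add ha hb)) hc.le,
            Polynomial.homogenize_mul _ _ ha hb, map_mul, map_mul]
        have e2 : n + n + n = (β + α + γ) + S := by omega
        have hF1 : (C d * X ^ α : ℤ[X]).natDegree ≤ β + α :=
          (natDegree_C_mul_le _ _).trans ((natDegree_pow_le_of_le α natDegree_X_le).trans (by omega))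
        have hF2 : ((X - 1 : ℤ[X]) ^ γ).natDegree ≤ γ :=
          (natDegree_pow_le_of_le γ hX1deg.le).trans (by omega)
        have hF12 : (C d * X ^ α * (X - 1) ^ γ : ℤ[X]).natDegree ≤ β + α + γ :=
          natDegree_mul_le.trans (add_le_add hF1 hF2)
        have hF3 : (∏ i, P i ^ e i).natDegree ≤ S :=
          (natDegree_prod_le _ _).trans (Finset.sum_le_sum fun i _ => natDegree_pow_le)
        have hγ := homogenize_pow' (X - 1 : ℤ[X]) (m := 1) hX1deg.le γ
        rw [mul_one] at hγ
        rw [e1, e2, hfac, Polynomial.homogenize_mul _ _ hF12 hF3, Polynomial.homogenize_mul _ _ hF1 hF2,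
          Polynomial.homogenize_mul _ _ (by simp) (natDegree_pow_le_of_le α natDegree_X_le |>.trans
            (by omega)), hγ, hS,
          Polynomial.homogenize_finsetProd (fun i _ => natDegree_pow_le),
          Polynomial.homogenize_X_pow le_rfl]
        simp only [map_mul, map_pow, map_prod, eval_homogenize_C, eval_homogenize_X_sub_one,
          MvPolynomial.eval_X, Matrix.cons_val_zero, Nat.sub_self, pow_zero,
          mul_one]
        congr 1
        refine Finset.prod_congr rfl fun i _ => ?_
        rw [homogenize_pow' (P i) le_rfl, map_pow]
      -- pass to natural numbers
      have hq0 : ∀ i, q i ≠ 0 := by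
        intro i hqi
        apply mul_ne_zero (mul_ne_zero hA0 hB0) hC0
        rw [HABC, Finset.prod_eq_zero (Finset.mem_univ i) (by rw [hqi, zero_pow (he i).ne'])]
        simp
      set N : ℕ := (A * B * Cv).natAbs with hN
      have hN0 : N ≠ 0 := Int.natAbs_ne_zero.mpr (mul_ne_zero (mul_ne_zero hA0 hB0) hC0)
      have hNfac : N = d.natAbs * (v ^ β * u ^ α * (v - u) ^ γ) * ∏ i, (q i).natAbs ^ e i := by
        have hUV' : (U - V).natAbs = v - u := by rw [hU, hV]; omega
        have hprodabs' : ∀ s : Finset (Fin m),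
            (∏ i ∈ s, q i ^ e i).natAbs = ∏ i ∈ s, (q i).natAbs ^ e i := by
          intro s
          induction s using Finset.induction_on with
          | empty => simp
          | insert i s hi ih =>
            rw [Finset.prod_insert hi, Finset.prod_insert hi, Int.natAbs_mul, Int.natAbs_pow, ih]
        have hprodabs : (∏ i, q i ^ e i).natAbs = ∏ i, (q i).natAbs ^ e i := hprodabs' univ
        rw [hN, HABC, Int.natAbs_mul, Int.natAbs_mul, Int.natAbs_mul, Int.natAbs_mul, hprodabs,
          Int.natAbs_pow, Int.natAbs_pow, Int.natAbs_pow, hUV', hU, hV, Int.natAbs_natCast,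
          Int.natAbs_natCast]
        ring
      -- `a' b' c' ∣ N`
      have hdvdN : a' * b' * c' ∣ N := by
        refine ⟨g ^ 3, ?_⟩
        rw [hprod, hN, hx, hy, hz,
          show (g : ℤ) * x * ((g : ℤ) * y) * ((g : ℤ) * z) = (x * y * z) * (g : ℤ) ^ 3 by ring,
          Int.natAbs_mul, Int.natAbs_pow, Int.natAbs_natCast]
      -- radical chain in `ℕ`
      have hradN : radical N ≤ d.natAbs * radical (u * v * (v - u)) * ∏ i, (q i).natAbs := by
        have hdv : radical N ∣ d.natAbs * radical (u * v * (v - u)) * ∏ i, (q i).natAbs := by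
          rw [hNfac]
          refine radical_mul_dvd.trans (mul_dvd_mul (radical_mul_dvd.trans (mul_dvd_mul
            radical_dvd_self (radical_special_dvd u v (v - u) α β γ hu hvpos (by omega)))) ?_)
          exact (radical_prod_dvd _ _).trans (Finset.prod_dvd_prod_of_dvd _ _ fun i _ =>
            (radical_pow_dvd_radical _ _).trans radical_dvd_self)
        refine Nat.le_of_dvd ?_ hdv
        refine Nat.mul_pos (Nat.mul_pos (Int.natAbs_pos.mpr hd0) hspec_pos) ?_
        exact Finset.prod_pos fun i _ => Int.natAbs_pos.mpr (hq0 i)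
      have hrad1 : rad a' b' c' ≤ radical N := by
        rw [rad_def]
        exact Nat.le_of_dvd (Nat.pos_of_ne_zero radical_ne_zero) (radical_dvd_radical hdvdN hN0)
      -- size of the `qᵢ`
      have hqle : ∀ i, ((q i).natAbs : ℝ) ≤ (NP i : ℝ) * (v : ℝ) ^ (P i).natDegree := by
        intro i
        have h := abs_eval_homogenize_le (P i) (P i).natDegree hUV
        rw [← hNPcast i] at h
        have h' : (((q i).natAbs : ℕ) : ℤ) ≤ (NP i : ℤ) * V ^ (P i).natDegree := by
          rw [Int.natCast_natAbs]; exact h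
        have h'' : (((q i).natAbs : ℤ) : ℝ) ≤ (((NP i : ℤ) * V ^ (P i).natDegree : ℤ) : ℝ) := by
          exact_mod_cast h'
        simpa [hV] using h''
      have hprodq : (∏ i, ((q i).natAbs : ℝ)) ≤ (∏ i, (NP i : ℝ)) * (v : ℝ) ^ (∑ i, (P i).natDegree) := by
        rw [← Finset.prod_pow_eq_pow_sum, ← Finset.prod_mul_distrib]
        exact Finset.prod_le_prod (fun i _ => Nat.cast_nonneg _) fun i _ => hqle i
      have hfinal : ((rad a' b' c' : ℕ) : ℝ) ≤
          (d.natAbs : ℝ) * ((radical (u * v * (v - u)) : ℕ) : ℝ) * ∏ i, ((q i).natAbs : ℝ) := by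
        have := hrad1.trans hradN
        exact_mod_cast this
      calc ((rad a' b' c' : ℕ) : ℝ)
          ≤ (d.natAbs : ℝ) * ((radical (u * v * (v - u)) : ℕ) : ℝ) * ∏ i, ((q i).natAbs : ℝ) := hfinal
        _ ≤ (d.natAbs : ℝ) * ((radical (u * v * (v - u)) : ℕ) : ℝ) *
              ((∏ i, (NP i : ℝ)) * (v : ℝ) ^ (∑ i, (P i).natDegree)) := by gcongr
        _ = M * ((radical (u * v * (v - u)) : ℕ) : ℝ) * (v : ℝ) ^ (∑ i, (P i).natDegree) := by
              simp only [M]; ring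
  · /- small `v`: the trivial triple `(u, v − u, v)` -/
    have hvle : v ≤ v₀ := not_lt.mp hv
    refine ⟨u, v - u, v, ⟨hu, by omega, by omega, (Nat.coprime_sub_self_right huv.le).mpr hcuv⟩,
      ?_, ?_⟩
    · have hvR : (v : ℝ) ≤ (v₀ : ℝ) + 1 := by exact_mod_cast Nat.le_succ_of_le hvle
      have hpow : (v : ℝ) ^ n ≤ ((v₀ : ℝ) + 1) ^ n := pow_le_pow_left₀ (Nat.cast_nonneg _) hvR n
      have hv1 : (1 : ℝ) ≤ v := by exact_mod_cast hvpos
      have hLG1 : (1 : ℝ) ≤ (L : ℝ) * G := by exact_mod_cast Nat.mul_pos hL hG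
      show 1 / (((L : ℝ) * G) * ((v₀ : ℝ) + 1) ^ n) * (v : ℝ) ^ n ≤ v
      rw [div_mul_eq_mul_div, one_mul, div_le_iff₀ (by positivity)]
      have h0 : (0 : ℝ) ≤ ((v₀ : ℝ) + 1) ^ n := by positivity
      nlinarith [mul_nonneg (sub_nonneg.mpr hLG1) h0, mul_nonneg (sub_nonneg.mpr hv1)
        (mul_nonneg (hLGpos.le) h0)]
    · rw [rad_def, show u * (v - u) * v = u * v * (v - u) by ring]
      have hX : (0 : ℝ) ≤ ((radical (u * v * (v - u)) : ℕ) : ℝ) := Nat.cast_nonneg _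
      have hvs : (1 : ℝ) ≤ (v : ℝ) ^ (∑ i, (P i).natDegree) := one_le_pow₀ (by exact_mod_cast hvpos)
      nlinarith [mul_nonneg (mul_nonneg (sub_nonneg.mpr hM1) hX) (le_trans zero_le_one hvs),
        mul_nonneg hX (sub_nonneg.mpr hvs)]

/-- **No gain from any identity.**  Combining the bridge with `no_covering_gain`: an identity as in
`coveringData_of_forms` with `s = Σ deg Pᵢ ≥ n − 1` (which is the projective Mason–Stothers count)
transfers `PolyABC K` (`K ≥ 1`) into a floor exponent `θ ≤ 1/K` on `rad(u v (v − u))` — never more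
than the identity map gives. [folklore] -/
theorem forms_no_gain {a b c : ℤ[X]} {n : ℕ} (hn : 1 ≤ n) (hsum : a + b = c)
    (hc : c.natDegree = n) (ha : a.natDegree ≤ n) (ha0 : a ≠ 0) (hb0 : b ≠ 0)
    (hcop : IsCoprime (a.map (Int.castRingHom ℚ)) (c.map (Int.castRingHom ℚ)))
    {m : ℕ} {d : ℤ} {α γ : ℕ} {P : Fin m → ℤ[X]} {e : Fin m → ℕ} (he : ∀ i, 0 < e i)
    (hfac : a * b * c = C d * X ^ α * (X - 1) ^ γ * ∏ i, P i ^ e i)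
    (hs : n ≤ (∑ i, (P i).natDegree) + 1) {K : ℝ} (hK : 1 ≤ K) (hP : PolyABC K) :
    ∃ θ κ' : ℝ, θ ≤ 1 / K ∧ 0 < κ' ∧ ∀ u v : ℕ, 0 < u → u < v → Nat.Coprime u v →
      κ' * (v : ℝ) ^ θ ≤ ((radical (u * v * (v - u)) : ℕ) : ℝ) :=
  no_covering_gain (coveringData_of_forms hn hsum hc ha ha0 hb0 hcop he hfac) hs hK hP

end Summit.ABC.ABC.Theorems

end
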